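import Mathlib.Analysis.Calculus.LineDeriv.IntegrationByParts
import Literature.Analysis.FunctionSpaces.SobolevDomainUnivProofs
import HarnessLib

/-!
# Square-integrable functions as tempered distributions; `C^k_c ⊂ H^k`; elliptic regularity of `Δ` in the Bessel scale

Analysis/FunctionSpaces support file, first of the chain that discharges the named fact
`Literature.Analysis.FluidPDE.tsai1998_profile_smooth` (`FluidPDE/TsaiGrowthLemmas`; Tsai 1998,
p. 33: weak solutions of Leray's profile system are smooth) by the classical `H^s`-bootstrap
(Folland, *Introduction to PDE*, 2nd ed., Ch. 6: Sobolev spaces `H_s` through the Fourier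
transform, the Sobolev lemma (6.5), the algebra property of `H_s` for `s > n/2` (§6.A,
Exercise 4) and the local elliptic regularity theorem (6.33)).

Mathlib (this pin) has tempered distributions `𝓢'(E, F)`, their derivatives `∂_{v}`, Laplacian
`Δ` and Fourier transform, the Bessel potentials `J^s = besselPotential E F s` and the
Bessel-potential Sobolev classes `TemperedDistribution.MemSobolev s p` (M. Doll, 2026), with
`MemSobolev.mono/lineDerivOp/laplacian`; the tree (`SobolevDomainUnivProofs`) adds
`J² = 1 - (2π)⁻² Δ` (`besselPotential_two_eq`) and `H^{s+1} = {u ∈ H^s : ∂ᵥu ∈ H^s}`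
(`memSobolev_add_one_iff`, Folland (6.3)). This file adds:

* `MemSobolev.of_laplacian` — **elliptic regularity for `Δ` on the whole space in the Bessel
  scale**: `u ∈ H^{s-2}` and `Δu ∈ H^{s-2}` imply `u ∈ H^s` (from `J² = 1 - (2π)⁻²Δ`; Folland,
  proof of (6.33) / Lemma (6.32) for `L = Δ`, where it is immediate from (6.4)).
* `fnTD f` — the tempered distribution `φ ↦ ∫ φ f` of a square-integrable `f : E → ℂ`, as a
  *total* function of `f` (Mathlib's `Lp.toTemperedDistribution (hf.toLp f)` needs the proof
  `hf : MemLp f 2`; the wrapper lets `fnTD (χ · h)` be quantified over cut-offs `χ`, see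
  `SobolevLocal`), with junk value `0` off `L²`; its evaluation (`fnTD_apply`) and linearity.
* `lineDerivOp_fnTD` — for `f ∈ C¹_c`, the distributional derivative of `T_f` is `T_{∂ᵥf}`
  (integration by parts, Mathlib's `integral_bilinear_hasLineDerivAt_right_eq_neg_left_of_integrable`).
* `memSobolev_fnTD_of_contDiff` — **`C^k_c ⊂ H^k`**: `T_f ∈ H^k` for `f ∈ C^k` with compact
  support (induction on `k` with `memSobolev_add_one_iff`).

All statements are for a finite-dimensional real inner product space `E` with its Lebesgue
measure and complex-valued functions (the PDE files complexify real data componentwise).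

## References

* G. B. Folland, *Introduction to Partial Differential Equations*, 2nd ed., Princeton UP 1995,
  §6.A ((6.3), (6.4), (6.5)), §6.C ((6.32), (6.33)). [Folland1995PDE]
* T.-P. Tsai, *On Leray's self-similar solutions of the Navier–Stokes equations satisfying
  local energy estimates*, ARMA 143 (1998), p. 33. [Tsai1998]
-/

noncomputable section

open MeasureTheory TemperedDistribution
open scoped ENNReal FourierTransform LineDeriv Laplacian Real SchwartzMap ContDiff

namespace Literature.Analysis.FunctionSpaces

section EllipticRegularity

variable {E F : Type*} [NormedAddCommGroup E] [InnerProductSpace ℝ E] [FiniteDimensional ℝ E]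
  [MeasurableSpace E] [BorelSpace E] [NormedAddCommGroup F] [InnerProductSpace ℂ F]
  [CompleteSpace F]

/-- **Elliptic regularity for `Δ` in the Bessel scale** (whole space): if `u ∈ H^{s-2}` and
`Δ u ∈ H^{s-2}` then `u ∈ H^s`. Proof: `J² u = u - (2π)⁻² Δ u ∈ H^{s-2}` and `J²` is an
isomorphism `H^s → H^{s-2}` (Folland, *Introduction to PDE*, (6.4) and Lemma (6.32) for `L = Δ`).
[cite: Folland1995PDE, §6.A (6.4)] -/
theorem MemSobolev.of_laplacian {s : ℝ} {u : 𝓢'(E, F)} (hu : MemSobolev (s - 2) 2 u)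
    (hΔ : MemSobolev (s - 2) 2 (Δ u)) : MemSobolev s 2 u := by
  have h : MemSobolev (s - 2) 2 (besselPotential E F 2 u) := by
    rw [besselPotential_two_eq]
    exact hu.sub (hΔ.smul _)
  rw [memSobolev_besselPotential_iff] at h
  have e : (2 : ℝ) + (s - 2) = s := by ring
  rw [e] at h
  exact h

end EllipticRegularity

variable {E : Type*} [NormedAddCommGroup E] [InnerProductSpace ℝ E] [FiniteDimensional ℝ E]
  [MeasurableSpace E] [BorelSpace E]

/-! ### The tempered distribution of a square-integrable function -/

open Classical in
/-- The tempered distribution `T_f : φ ↦ ∫ φ(x) f(x) dx` of a square-integrable function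
`f : E → ℂ` (Folland, *Introduction to PDE*, §0.E: locally integrable functions as
distributions), as a total function of `f`: Mathlib's `Lp.toTemperedDistribution` applied to the
`L²` class of `f` when `f ∈ L²`, and the junk value `0` otherwise. [folklore] -/
def fnTD (f : E → ℂ) : 𝓢'(E, ℂ) :=
  if hf : MemLp f 2 (volume : Measure E) then
    MeasureTheory.Lp.toTemperedDistribution (hf.toLp f) else 0

/-- A Schwartz function times an `L²` function is integrable (Cauchy–Schwarz). [folklore] -/
theorem integrable_schwartz_mul {f : E → ℂ} (hf : MemLp f 2 (volume : Measure E))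
    (φ : 𝓢(E, ℂ)) : Integrable (fun x => φ x * f x) := by
  have h2 : MemLp (φ : E → ℂ) 2 (volume : Measure E) := φ.memLp 2
  exact h2.integrable_mul hf

/-- Evaluation of `T_f`: `T_f φ = ∫ φ f` for `f ∈ L²`. [folklore] -/
theorem fnTD_apply {f : E → ℂ} (hf : MemLp f 2 (volume : Measure E)) (φ : 𝓢(E, ℂ)) :
    fnTD f φ = ∫ x, φ x * f x := by
  rw [fnTD, dif_pos hf, MeasureTheory.Lp.toTemperedDistribution_apply]
  refine integral_congr_ae ?_
  filter_upwards [hf.coeFn_toLp] with x hx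
  rw [hx, smul_eq_mul]

/-- `T_f ∈ H⁰ = L²` (for every `f`, thanks to the junk value). [folklore] -/
theorem memSobolev_zero_fnTD (f : E → ℂ) : MemSobolev 0 2 (fnTD f) := by
  by_cases hf : MemLp f 2 (volume : Measure E)
  · rw [fnTD, dif_pos hf]
    exact ⟨hf.toLp f, by simp only [besselPotential_zero, ContinuousLinearMap.id_apply]⟩
  · rw [fnTD, dif_neg hf]
    exact memSobolev_fun_zero E ℂ 0 2

/-- Additivity of `f ↦ T_f` on `L²`. [folklore] -/
theorem fnTD_add {f g : E → ℂ} (hf : MemLp f 2 (volume : Measure E))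
    (hg : MemLp g 2 (volume : Measure E)) :
    fnTD (fun x => f x + g x) = fnTD f + fnTD g := by
  ext φ
  change fnTD (fun x => f x + g x) φ = fnTD f φ + fnTD g φ
  rw [fnTD_apply (show MemLp (fun x => f x + g x) 2 volume from hf.add hg), fnTD_apply hf,
    fnTD_apply hg, ← integral_add
    (integrable_schwartz_mul hf φ) (integrable_schwartz_mul hg φ)]
  refine integral_congr_ae (Filter.Eventually.of_forall fun x => ?_)
  simp [mul_add]

/-- Homogeneity of `f ↦ T_f` on `L²`. [folklore] -/
theorem fnTD_const_mul {f : E → ℂ} (hf : MemLp f 2 (volume : Measure E)) (c : ℂ) :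
    fnTD (fun x => c * f x) = c • fnTD f := by
  ext φ
  change fnTD (fun x => c * f x) φ = c • fnTD f φ
  rw [fnTD_apply (hf.const_mul c), fnTD_apply hf, smul_eq_mul, ← integral_const_mul]
  refine integral_congr_ae (Filter.Eventually.of_forall fun x => ?_)
  ring

/-- `T_{-f} = -T_f` on `L²`. [folklore] -/
theorem fnTD_neg {f : E → ℂ} (hf : MemLp f 2 (volume : Measure E)) :
    fnTD (fun x => -f x) = -fnTD f := by
  have := fnTD_const_mul hf (-1)
  simpa using this

/-- `T_{f-g} = T_f - T_g` on `L²`. [folklore] -/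
theorem fnTD_sub {f g : E → ℂ} (hf : MemLp f 2 (volume : Measure E))
    (hg : MemLp g 2 (volume : Measure E)) :
    fnTD (fun x => f x - g x) = fnTD f - fnTD g := by
  simp only [sub_eq_add_neg]
  rw [fnTD_add hf (show MemLp (fun x => -g x) 2 volume from hg.neg), fnTD_neg hg]

/-- `f ↦ T_f` commutes with finite sums on `L²`. [folklore] -/
theorem fnTD_finset_sum {ι : Type*} (S : Finset ι) {f : ι → E → ℂ}
    (hf : ∀ i ∈ S, MemLp (f i) 2 (volume : Measure E)) :
    fnTD (fun x => ∑ i ∈ S, f i x) = ∑ i ∈ S, fnTD (f i) := by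
  classical
  induction S using Finset.induction_on with
  | empty =>
    simp only [Finset.sum_empty]
    ext φ
    rw [fnTD_apply MemLp.zero']
    simp
  | insert a S ha ih =>
    simp only [Finset.sum_insert ha]
    rw [fnTD_add (hf a (by simp)) (memLp_finsetSum S fun i hi => hf i (by simp [hi])),
      ih fun i hi => hf i (by simp [hi])]

/-- A smooth compactly supported cut-off times a continuous function is in `L²`. [folklore] -/
theorem memLp_cutoff_mul {χ h : E → ℂ} (hχ : ContDiff ℝ ∞ χ) (hχs : HasCompactSupport χ)
    (hc : Continuous h) : MemLp (fun x => χ x * h x) 2 (volume : Measure E) :=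
  (hχ.continuous.mul hc).memLp_of_hasCompactSupport hχs.mul_right

/-! ### Distributional derivatives of `C¹_c` functions; `C^k_c ⊂ H^k` -/

/-- **Distributional = classical derivative for `C¹_c`**: for `f ∈ C¹` with compact support,
`∂ᵥ T_f = T_{∂ᵥ f}` in `𝓢'` (integration by parts against Schwartz functions; Folland,
*Introduction to PDE*, §0.E). [folklore] -/
theorem lineDerivOp_fnTD {f : E → ℂ} (hf : ContDiff ℝ 1 f) (hfs : HasCompactSupport f) (v : E) :
    ∂_{v} (fnTD f) = fnTD (fun x => fderiv ℝ f x v) := by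
  have hfc : Continuous f := hf.continuous
  have hf'c : Continuous (fun x => fderiv ℝ f x v) :=
    (hf.continuous_fderiv one_ne_zero).clm_apply continuous_const
  have hf's : HasCompactSupport (fun x => fderiv ℝ f x v) :=
    hfs.fderiv_apply (𝕜 := ℝ) v
  have hfL : MemLp f 2 (volume : Measure E) := hfc.memLp_of_hasCompactSupport hfs
  have hf'L : MemLp (fun x => fderiv ℝ f x v) 2 (volume : Measure E) :=
    hf'c.memLp_of_hasCompactSupport hf's
  ext φ
  rw [lineDerivOp_apply_apply, fnTD_apply hfL, fnTD_apply hf'L]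
  have hibp := integral_bilinear_hasLineDerivAt_right_eq_neg_left_of_integrable
    (μ := (volume : Measure E)) (B := ContinuousLinearMap.mul ℝ ℂ) (f := f)
    (f' := fun x => fderiv ℝ f x v) (g := fun x => φ x) (g' := fun x => fderiv ℝ φ x v) (v := v)
    ?_ ?_ ?_ ?_ ?_
  · simp only [ContinuousLinearMap.mul_apply'] at hibp
    simp only [neg_apply, SchwartzMap.lineDerivOp_apply_eq_fderiv, neg_mul]
    rw [integral_neg]
    simp_rw [mul_comm _ (f _)]
    rw [hibp, neg_neg]
    exact integral_congr_ae (Filter.Eventually.of_forall fun x => mul_comm _ _)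
  · exact (hf'c.mul φ.continuous).integrable_of_hasCompactSupport (hf's.mul_right)
  · exact (hfc.mul ((φ.smooth 1).continuous_fderiv one_ne_zero |>.clm_apply
      continuous_const)).integrable_of_hasCompactSupport hfs.mul_right
  · exact (hfc.mul φ.continuous).integrable_of_hasCompactSupport hfs.mul_right
  · intro x _
    exact ((hf.differentiable one_ne_zero) x).hasFDerivAt.hasLineDerivAt v
  · intro x _
    exact (φ.differentiableAt).hasFDerivAt.hasLineDerivAt v

/-- **`C^k_c ⊂ H^k`**: the distribution of a `C^k` function with compact support is in the
Bessel-potential space `H^k` (Folland, *Introduction to PDE*, §6.A, the remark after (6.1):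
`H_k ⊃` functions with `k` classical derivatives in `L²`; here by induction on `k` through
`H^{k+1} = {u ∈ H^k : ∂ᵥu ∈ H^k}` and `lineDerivOp_fnTD`). [cite: Folland1995PDE, §6.A Theorem (6.3), p. 192] -/
theorem memSobolev_fnTD_of_contDiff {k : ℕ} {f : E → ℂ} (hf : ContDiff ℝ k f)
    (hfs : HasCompactSupport f) : MemSobolev (k : ℝ) 2 (fnTD f) := by
  induction k generalizing f with
  | zero => simpa using memSobolev_zero_fnTD f
  | succ k ih =>
    have hk : MemSobolev (k : ℝ) 2 (fnTD f) :=
      ih (hf.of_le (by exact_mod_cast Nat.le_succ k)) hfs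
    have h1 : ContDiff ℝ 1 f := hf.of_le (by exact_mod_cast Nat.le_add_left 1 k)
    have e : ((k + 1 : ℕ) : ℝ) = (k : ℝ) + 1 := by push_cast; ring
    rw [e, memSobolev_add_one_iff]
    refine ⟨hk, fun v => ?_⟩
    rw [lineDerivOp_fnTD h1 hfs]
    exact ih ((hf.fderiv_right (m := k) (by norm_cast)).clm_apply contDiff_const)
      (hfs.fderiv_apply (𝕜 := ℝ) v)

end Literature.Analysis.FunctionSpaces
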